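/-
Copyright (c) 2026. All rights reserved.
Released under Apache 2.0 license as described in the file LICENSE.
-/
import Literature.Probability.FitznerVanDerHofstad2017.NobleBoundsNMidF1
import Literature.Probability.FitznerVanDerHofstad2017.NobleBoundsNMidSOpen
import HarnessLib

/-!
# Fitzner–van der Hofstad (2017), §6.1 (6.4) / (5.4): a middle junction, variant `F″` CUT THROUGH THE APEX (`z = t ≠ y`), off the corner `w′ ~ t` — term 2 at `u = t`

[FvdH17] = R. Fitzner, R. van der Hofstad, *Mean-field behavior for nearest-neighbor percolation in `d > 10`*,
arXiv:1506.07977v2 (EJP 22 (2017), paper 43).  Page numbers refer to the arXiv version.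

Continuation of `NobleBoundsNMidF1` (variant `F′`: `t = y`).  Here the upper level `k + 1` of a middle junction
`k = i₀ + 1` is of kind `midE` with `t_k ≠ u_{k+1}` (`F″` of (4.58), p. 41: the exit `w_{k+1}` branches off
strictly before the last sausage) in the sub-regime `z_k = t_k` (the level-`k` cluster cuts through the APEX of
the last sausage: the sausage line `t – z` is a loop and the two routes `t → u_{k+1}`, `z → u_{k+1}` are two
disjoint `t – u_{k+1}` connections).  By clause (8) of `NobleJointNLevel.Conds` the exit class above is `a′ = 2`
(`NobleBoundsNJointKit.JFacts.exitClass_succ_eq_two_of_sharp`; the cells handed with `a′ ≤ 1` are empty,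
`nonempty_jPkg_of_sharp`).  These configurations are charged to TERM 2 of (5.4) (p. 48) at `u = t`:
`δ_{z,t} · A^{κ,a,2}(u_k, w_k, w_{k+1}, t) · P^{S,0}(u_{k+1} − t, u_{k+1} − t)`
(App. B Table "A^{ι,a,b}" rows `(a, ≥2)`, p. 75; Table "P^b" row `b = 0`, p. 73): the letter `A^{κ,a,2}` reads
the bond `b_k`, the entry lines `b̄_k → w_{k+1}`, `w_{k+1} ←≥2→ t` and the exit line `w_k → z_k = t` of level `k`
— exactly the rows `piPerc_midF1_{zero,one,two}_two_le_blockAiota` of `NobleBoundsNMidF1`, the index `≥ 2` on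
`(w_{k+1}, t)` being available OFF THE CORNER `w_{k+1} ~ t` (hypothesis `¬ Adj w_{k+1} t`; `w_{k+1} ≠ t` is the
`midE` canon): on the corner (`R = {|E₂| = 1}` of DIVERGENCE D77 of the b2b-lace packet) the row does not fit and
nothing is claimed here (LEMMAS ADDENDUM 13 §13.4/13.5, ADDENDUM 16 §16.2 row "(true,0) | 2 | t ≠ u′, ¬Adj");
the letter `P^{S,0}(u_{k+1} − t, u_{k+1} − t) = ℙ(t ⇔ u_{k+1})` reads the two routes (slots `3, 4` of level
`k + 1`) in ONE letter (`NobleBoundsN1ClassTools.piPerc_end_zero_le_blockPE`, `P^{E,0} = P^{S,0}`).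

§A the grouping `glMidS12` (of `NobleBoundsNMidSOpen`) over a `midE` level and the two readings; §B the
parameter facts; §C the core and the cells `nonempty_jPkg_midE_cut` (target `A^{κ,a,2} · P^{S,0}`) with the
literal term-2 shapes `nonempty_jPkg_midE_cut_term₂` / `_term₂'` (`δ_{z,t}(A^κ · P^{S,0})`, landed / primed
`A^κ` — equal here since `a′ = 2`).

Conventions: `d`-generic; nothing is cited as a fact; additive (no existing declaration is changed).
-/

noncomputable section

namespace Literature.Probability.FitznerVanDerHofstad2017

open Literature.Barriers.CriticalPhenomena Literature.Probability.Percolation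
open Literature.Probability.LatticeModels Literature.Combinatorics.SimpleGraph _root_.SimpleGraph
open _root_.MeasureTheory
open Literature.Probability.FitznerVanDerHofstad2017.NobleBlocks
open Literature.Probability.FitznerVanDerHofstad2017.NobleBlocks.LenIdx
open scoped ENNReal

variable {d : ℕ}

/-! ### A. The grouping over a `midE` level and the readings -/

section Grouping

variable (M : ℕ) (x : Site d) (b : Fin (M + 2) → Site d × Site d) (w t z : Fin (M + 2) → Site d)
  (a : Fin (M + 2) → Fin 3 ⊕ Unit) (τ : Fin (M + 1) → Bool × Fin 3)

/-- **The grouping `glMidS12` obeys the (4.65) rule over a `midE` level too**: its only cross-level letter joins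
the lower exit line with the ENTRY slots `0, 1` of level `k + 1` (a `midE` level has the entry slots `0, 1, 2`).
[cite: FitznerVanDerHofstad2017, §4.4 (4.65) and the sentence after it (arXiv:1506.07977v2 p. 43)] -/
theorem glMidS12_entry_midE (i : Fin (M + 1)) (hσ : (τ i).1 = true) {a' : Fin 3} (ha' : a i.succ = Sum.inl a')
    (j j' : Fin 6) (hg : glMidS12 (.lo j) = glMidS12 (.up j')) :
    IsEntry (pieceViews M x b w t z a τ i.castSucc.succ).kd j' := by
  rw [pieceViews_mid_kd, ha', hσ]
  show (j' : ℕ) < 3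
  fin_cases j' <;> simp [glMidS12] at hg ⊢

end Grouping

section Letter

variable (p : unitInterval) (M : ℕ) (x : Site d) (b : Fin (M + 2) → Site d × Site d) (w t z : Fin (M + 2) → Site d)
  (a : Fin (M + 2) → Fin 3 ⊕ Unit) (τ : Fin (M + 1) → Bool × Fin 3)

/-- **Four-line reading of the letter `xb`** under `glMidS12` over a `midE` level: bond (level `k`),
`b̄_k → w_{k+1}`, `w_{k+1} → t_k` (level `k + 1`), exit line (level `k`).
[cite: FitznerVanDerHofstad2017, §4.2 (4.18) (arXiv:1506.07977v2 p. 35); §6.1 (6.4) (p. 58)] -/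
theorem junF_midECut_xb_le₄ (i i₀ : Fin (M + 1)) (hk : i₀.succ = i.castSucc) (hσ : (τ i).1 = true)
    {a₀ a' : Fin 3} (ha : a i.castSucc = Sum.inl a₀) (ha' : a i.succ = Sum.inl a')
    (EB E0 E1 E2 E3 E4 X5 : Set (BondConfig (Site d))) :
    junF p M x b w t z a τ i.castSucc glMidS12 true false (midEv EB E0 E1 E2 E3 E4 X5) .xb ≤
      piPerc d p 2 (genDisjOcc ![EB, E0, E1, X5] ![0, 1, 1, 0]) := by
  refine junF_le_of_lines p M x b w t z a τ i.castSucc glMidS12 true false _ JIdx.xb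
    ![JIdx.xb, .up 0, .up 1, .lo 5] (by decide) (fun m => ?_) ![0, 1, 1, 0] (fun m => by fin_cases m <;> rfl)
    ![EB, E0, E1, X5] (by funext m; fin_cases m <;> rfl)
  fin_cases m
  · exact ⟨rfl, rfl⟩
  · exact ⟨(jMidE_act_up_iff M x b w t z a τ i hσ ha' true false 0).2 (by decide), rfl⟩
  · exact ⟨(jMidE_act_up_iff M x b w t z a τ i hσ ha' true false 1).2 (by decide), rfl⟩
  · exact ⟨(jMidOpen_act_lo_iff M x b w t z a τ i i₀ hk ha true false 5).2 rfl, rfl⟩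

/-- **Two-line reading of the letter `up 2`** under `glMidS12` over a `midE` level: the two routes `t_k → u_{k+1}`
(slot `3`) and `z_k → u_{k+1}` (slot `4`) of the last sausage in ONE letter (the loop `t – z`, slot `2`, dropped).
[cite: FitznerVanDerHofstad2017, §4.2 (4.16) (arXiv:1506.07977v2 p. 36); (4.58) (p. 41)] -/
theorem junF_midECut_up_le₂ (i : Fin (M + 1)) (hσ : (τ i).1 = true) {a' : Fin 3} (ha' : a i.succ = Sum.inl a')
    (EB E0 E1 E2 E3 E4 X5 : Set (BondConfig (Site d))) :
    junF p M x b w t z a τ i.castSucc glMidS12 true false (midEv EB E0 E1 E2 E3 E4 X5) (.up 2) ≤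
      piPerc d p 2 (genDisjOcc ![E3, E4] ![1, 1]) := by
  refine junF_le_of_lines p M x b w t z a τ i.castSucc glMidS12 true false _ (JIdx.up 2)
    ![JIdx.up 3, .up 4] (by decide) (fun m => ?_) ![1, 1] (fun m => by fin_cases m <;> rfl)
    ![E3, E4] (by funext m; fin_cases m <;> rfl)
  fin_cases m
  · exact ⟨(jMidE_act_up_iff M x b w t z a τ i hσ ha' true false 3).2 (by decide), rfl⟩
  · exact ⟨(jMidE_act_up_iff M x b w t z a τ i hσ ha' true false 4).2 (by decide), rfl⟩

end Letter

/-! ### B. The parameter facts of the cut-through regime -/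

section CutFacts

variable {M : ℕ} {x : Site d} {b : Fin (M + 2) → Site d × Site d} {w t z : Fin (M + 2) → Site d}
  {a : Fin (M + 2) → Fin 3 ⊕ Unit} {c : Fin 3 ⊕ Unit} {τ : Fin (M + 1) → Bool × Fin 3}
  {ω : Fin (M + 3) → BondConfig (Site d)} {K₀ : Fin (M + 3) → Fin 6 → Set (Sym2 (Site d))}

/-- The PARAMETER FACTS of a non-empty `F″` piece at a middle junction `k = i₀ + 1`, read off `JFacts`: exit class
`2` above (clause (8)), `z_k ≠ u_{k+1}`, `w_{k+1} ≠ t_k` (`midE` canon), `u_k ∉ {t_k, w_{k+1}, z_k}`, `b̄_k ≠ z_k`, and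
the exit class of level `k` versus the parameters.
[cite: FitznerVanDerHofstad2017, (4.58)–(4.60), (4.64) and §6.1 "Case a" (arXiv:1506.07977v2 pp. 41–42, 58–59)] -/
theorem midECut_facts (hF : JFacts M x b w t z a c τ ω K₀) (i i₀ : Fin (M + 1)) (hk : i₀.succ = i.castSucc)
    (hσ : (τ i).1 = true) {a₀ a' : Fin 3} (ha : a i.castSucc = Sum.inl a₀) (ha' : a i.succ = Sum.inl a')
    (hty : t i.castSucc ≠ (b i.succ).1) :
    a' = 2 ∧ z i.castSucc ≠ (b i.succ).1 ∧ w i.succ ≠ t i.castSucc ∧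
      (b i.castSucc).1 ≠ t i.castSucc ∧ (b i.castSucc).1 ≠ w i.succ ∧ (b i.castSucc).1 ≠ z i.castSucc ∧
      (b i.castSucc).2 ≠ z i.castSucc ∧
      (a₀ = 0 → w i.castSucc = (b i.castSucc).1) ∧ (a₀ = 1 → (zdGraph d).Adj (b i.castSucc).1 (w i.castSucc)) := by
  have hv := hF.vac_midE i hσ ha'
  have hc := hF.canon_midE i hσ ha'
  refine ⟨hF.exitClass_succ_eq_two_of_sharp i hσ ha' hty, fun h => hty (hc.1.1 h), hc.2.resolve_right hty,
    fun h => hv (Or.inl h), fun h => hv (Or.inr (Or.inl h)), fun h => hv (Or.inr (Or.inr (Or.inl h))),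
    hF.v_ne_z_of_open i i₀ hk ha, ?_, ?_⟩
  · intro h0; exact hF.w_eq_of_exitClass_zero _ (ha.trans (by rw [h0]))
  · intro h1; exact (hF.exitClass_one _ (ha.trans (by rw [h1]))).2.2

end CutFacts

/-! ### C. The core and the cells -/

section Packages

variable (p : unitInterval) (M : ℕ) (x : Site d) (b : Fin (M + 2) → Site d × Site d) (w t z : Fin (M + 2) → Site d)
  (a : Fin (M + 2) → Fin 3 ⊕ Unit) (c : Fin 3 ⊕ Unit) (τ : Fin (M + 1) → Bool × Fin 3)

/-- **The core of the cut-through packages**: finitary events `E0 ⊇` the witness of `b̄_k → w_{k+1}`, `E1 ⊇` that of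
`w_{k+1} → t_k`, `E3, E4 ⊇` those of the two routes `t_k → u_{k+1}`, `z_k → u_{k+1}`, `X5 ⊇` the exit witness of
level `k` (the sausage loop, slot `2`, carries the sure event), and bounds of the two letters `xb ≤ T₁`,
`up 2 ≤ T₂` give a package with target `T₁ * T₂`.
[cite: FitznerVanDerHofstad2017, §6.1 (6.4) (arXiv:1506.07977v2 p. 58); §4.4 (4.58)–(4.60), (4.65) (pp. 41, 43)] -/
theorem nonempty_jPkg_midECut_core (i i₀ : Fin (M + 1)) (hk : i₀.succ = i.castSucc) (κ : Fin d × Bool)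
    (hb : (b i.castSucc).2 = (b i.castSucc).1 + stepVec κ) (hσ : (τ i).1 = true) {a₀ a' : Fin 3}
    (ha : a i.castSucc = Sum.inl a₀) (ha' : a i.succ = Sum.inl a') (E0 E1 E3 E4 X5 : Set (BondConfig (Site d)))
    (h0 : IsFinitary E0) (h1 : IsFinitary E1) (h3 : IsFinitary E3) (h4 : IsFinitary E4) (h5 : IsFinitary X5)
    (hmem : ∀ ω K₀, JFacts M x b w t z a c τ ω K₀ →
      K₀ i.castSucc.succ 0 ∈ E0 ∧ K₀ i.castSucc.succ 1 ∈ E1 ∧ K₀ i.castSucc.succ 3 ∈ E3 ∧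
        K₀ i.castSucc.succ 4 ∈ E4 ∧ K₀ i.castSucc.castSucc 5 ∈ X5)
    {T₁ T₂ : ℝ≥0∞}
    (hrow₁ : junF p M x b w t z a τ i.castSucc glMidS12 true false
      (midEv (event (eq 1) (b i.castSucc).1 (b i.castSucc).2) E0 E1 Set.univ E3 E4 X5) .xb ≤ T₁)
    (hrow₂ : junF p M x b w t z a τ i.castSucc glMidS12 true false
      (midEv (event (eq 1) (b i.castSucc).1 (b i.castSucc).2) E0 E1 Set.univ E3 E4 X5) (.up 2) ≤ T₂) :
    Nonempty (JPkg p (jctx M x b w t z a τ i.castSucc) (JFacts M x b w t z a c τ) (T₁ * T₂)) := by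
  have huv : (b i.castSucc).1 ≠ (b i.castSucc).2 := by
    rw [hb]; exact (zdGraph_adj_iff_stepVec _ _ |>.2 ⟨κ, rfl⟩).ne
  refine nonempty_jPkg_of_joint p i.castSucc glMidS12 true
    (midEv (event (eq 1) (b i.castSucc).1 (b i.castSucc).2) E0 E1 Set.univ E3 E4 X5)
    (isFinitary_midEv _ _ _ _ _ _ _ (isFinitary_event _ _ _) h0 h1 isFinitary_univ h3 h4 h5)
    (fun _ => by rw [midEv_xb]; exact singleton_mem_event_eq_one huv)
    (fun j j' _ _ hg => glMidS12_entry_midE M x b w t z a τ i hσ ha' j j' hg)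
    (fun ω K₀ hF => ⟨fun j hj => ?_, fun j hj => ?_⟩) ?_
  · -- the exit witness of level `k`
    obtain rfl := (jMidOpen_act_lo_iff M x b w t z a τ i i₀ hk ha true false j).1 hj
    rw [midEv_lo_five]
    exact (hmem ω K₀ hF).2.2.2.2
  · -- the witnesses of level `k + 1`
    have hj5 : j ≠ 5 := (jMidE_act_up_iff M x b w t z a τ i hσ ha' true false j).1 hj
    obtain ⟨m0, m1, m3, m4, -⟩ := hmem ω K₀ hF
    exact mem_midEv_up _ _ _ _ _ _ _ m0 m1 (Set.mem_univ _) m3 m4 j hj5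
  · -- two genuine letters
    exact (prod_junF_le₂ p M x b w t z a τ i.castSucc glMidS12 true false _
      (show JIdx.xb ≠ JIdx.up 2 by decide)).trans (mul_le_mul' hrow₁ hrow₂)

/-- **The cut-through cells `(a, ·, a′)` of a middle junction `k = i₀ + 1 ≤ M`, variant `F″` (`t_k ≠ u_{k+1}`), regime
`z_k = t_k`, off the corner `w_{k+1} ~ t_k`**: a package with target
`A^{κ,a,2}(u_k,w_k,w_{k+1},t_k) · P^{S,0}(u_{k+1} − t_k, u_{k+1} − t_k)`.  For `a′ ≤ 1` the piece is empty (clause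
(8)); for `a′ = 2` the `A`-letter is row `(a,2)` of App. B (the leg `w_{k+1} → t_k` has length `≥ 2` because
`w_{k+1} ≠ t_k` and the two are not neighbours) and the `P^{S,0}`-letter is the double connection `t_k ⇔ u_{k+1}`
furnished by the two routes of the last sausage.
[cite: FitznerVanDerHofstad2017, §5.1 (5.4) second term (arXiv:1506.07977v2 p. 48); §6.1 (6.4), "Case a = 0", "Cases a ≥ 1 and b ≥ 1" (pp. 58–59); App. B (pp. 73, 75)] -/
theorem nonempty_jPkg_midE_cut (i i₀ : Fin (M + 1)) (hk : i₀.succ = i.castSucc) (κ : Fin d × Bool)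
    (hb : (b i.castSucc).2 = (b i.castSucc).1 + stepVec κ) (hσ : (τ i).1 = true) (a₀ : Fin 3)
    (ha : a i.castSucc = Sum.inl a₀) {a' : Fin 3} (ha' : a i.succ = Sum.inl a')
    (hty : t i.castSucc ≠ (b i.succ).1) (hzt : z i.castSucc = t i.castSucc)
    (hna : ¬ (zdGraph d).Adj (w i.succ) (t i.castSucc)) :
    Nonempty (JPkg p (jctx M x b w t z a τ i.castSucc) (JFacts M x b w t z a c τ)
      (blockAiota (Letters.perc d p) κ a₀ a' (b i.castSucc).1 (w i.castSucc) (w i.succ) (t i.castSucc) *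
        blockPS (Letters.perc d p) 0 ((b i.succ).1 - t i.castSucc) ((b i.succ).1 - t i.castSucc))) := by
  -- exit class `a′ ≤ 1` above: the piece is empty (clause (8))
  by_cases h2 : a' = 2
  swap
  · exact nonempty_jPkg_of_sharp p c _ i hσ ha' h2 hty _
  subst h2
  -- degenerate parameters: the piece is empty
  by_cases hP : (b i.castSucc).1 ≠ t i.castSucc ∧ (b i.castSucc).1 ≠ w i.succ ∧ (b i.castSucc).1 ≠ z i.castSucc ∧
      (b i.castSucc).2 ≠ z i.castSucc ∧ w i.succ ≠ t i.castSucc ∧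
      (a₀ = 0 → w i.castSucc = (b i.castSucc).1) ∧ (a₀ = 1 → (zdGraph d).Adj (b i.castSucc).1 (w i.castSucc))
  swap
  · refine ⟨JPkg.vacuous p _ _ (fun ω K₀ hF => hP ?_) _⟩
    obtain ⟨-, -, hwt, hut, huw', huz, hvz, hw0, hw1⟩ := midECut_facts hF i i₀ hk hσ ha ha' hty
    exact ⟨hut, huw', huz, hvz, hwt, hw0, hw1⟩
  obtain ⟨hut, huw', huz, hvz, hwt, hw0, hw1⟩ := hP
  have h := nonempty_jPkg_midECut_core p M x b w t z a c τ i i₀ hk κ hb hσ ha ha'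
    (event (ge 0) (b i.castSucc).2 (w i.succ)) (event (ge 2) (w i.succ) (t i.castSucc))
    (event (ge 0) (t i.castSucc) (b i.succ).1) (event (ge 0) (t i.castSucc) (b i.succ).1)
    (endX a₀ (b i.castSucc).1 (w i.castSucc) (z i.castSucc))
    (isFinitary_event _ _ _) (isFinitary_event _ _ _) (isFinitary_event _ _ _) (isFinitary_event _ _ _)
    (isFinitary_endX _ _ _ _) (fun ω K₀ hF => ?_)
    (T₁ := blockAiota (Letters.perc d p) κ a₀ 2 (b i.castSucc).1 (w i.castSucc) (w i.succ) (t i.castSucc))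
    (T₂ := blockPS (Letters.perc d p) 0 ((b i.succ).1 - t i.castSucc) ((b i.succ).1 - t i.castSucc)) ?_ ?_
  · exact h
  · obtain ⟨h0, h1, -, h3, h4⟩ := hF.conn_midE i hσ ha'
    rw [hzt] at h4
    refine ⟨?_, ?_, ?_, ?_, midSOpen_exit_mem M x b w t z a c τ hF i i₀ hk ha huz hw0⟩
    · rw [event_ge]; exact mem_openConnGe_zero_of_mem h0
    · rw [event_ge]
      refine mem_openConnGe_two_of_notMem h1 hwt fun hm => hna ?_
      exact (SimpleGraph.mem_edgeSet _).1 (hF.lattice _ (hF.witness_subset _ 1 hm))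
    · rw [event_ge]; exact mem_openConnGe_zero_of_mem h3
    · rw [event_ge]; exact mem_openConnGe_zero_of_mem h4
  · refine (junF_midECut_xb_le₄ p M x b w t z a τ i i₀ hk hσ ha ha' _ _ _ _ _ _ _).trans ?_
    rw [hzt]
    unfold endX
    split_ifs with h0
    · subst h0
      rw [hw0 rfl]
      exact piPerc_midF1_zero_two_le_blockAiota p hb (fun h => hut h.symm) (fun h => huw' h.symm) _
    · obtain h1 | h2 : a₀ = 1 ∨ a₀ = 2 := by
        fin_cases a₀
        · exact absurd rfl h0
        · exact Or.inl rfl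
        · exact Or.inr rfl
      · subst h1
        obtain ⟨κ', hκ'⟩ := (zdGraph_adj_iff_stepVec _ _).1 (hw1 rfl)
        exact piPerc_midF1_one_two_le_blockAiota p hb hκ' _
      · subst h2
        exact piPerc_midF1_two_two_le_blockAiota p hb _
  · refine (junF_midECut_up_le₂ p M x b w t z a τ i hσ ha' _ _ _ _ _ _ _).trans ?_
    rw [← blockPE_zero]
    exact piPerc_end_zero_le_blockPE p rfl _ rfl

/-- **The cut-through cells in the literal shape of TERM 2** of `NobleBlocksPointwise.blockBpt`:
`δ_{z_k,t_k} · (A^{κ,a,a′}(u_k,w_k,w_{k+1},t_k) · P^{S,0}(u_{k+1} − t_k, u_{k+1} − t_k))`, landed `A^κ` family.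
[cite: FitznerVanDerHofstad2017, §5.1 (5.4) second term (arXiv:1506.07977v2 p. 48); §6.1 (6.4) (p. 58); App. B (pp. 73, 75)] -/
theorem nonempty_jPkg_midE_cut_term₂ (i i₀ : Fin (M + 1)) (hk : i₀.succ = i.castSucc) (κ : Fin d × Bool)
    (hb : (b i.castSucc).2 = (b i.castSucc).1 + stepVec κ) (hσ : (τ i).1 = true) (a₀ : Fin 3)
    (ha : a i.castSucc = Sum.inl a₀) {a' : Fin 3} (ha' : a i.succ = Sum.inl a')
    (hty : t i.castSucc ≠ (b i.succ).1) (hzt : z i.castSucc = t i.castSucc)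
    (hna : ¬ (zdGraph d).Adj (w i.succ) (t i.castSucc)) :
    Nonempty (JPkg p (jctx M x b w t z a τ i.castSucc) (JFacts M x b w t z a c τ)
      (kd (z i.castSucc) (t i.castSucc) *
        (blockAiota (Letters.perc d p) κ a₀ a' (b i.castSucc).1 (w i.castSucc) (w i.succ) (t i.castSucc) *
          blockPS (Letters.perc d p) 0 ((b i.succ).1 - t i.castSucc) ((b i.succ).1 - t i.castSucc)))) := by
  rw [hzt, kd_self, one_mul]
  exact nonempty_jPkg_midE_cut p M x b w t z a c τ i i₀ hk κ hb hσ a₀ ha ha' hty hzt hna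

/-- The same against the PRIMED `A^κ` family (equal here: `a′ = 2` on the non-empty pieces).
[cite: FitznerVanDerHofstad2017, §5.1 (5.4) second term (arXiv:1506.07977v2 p. 48); §6.1 (6.4) (pp. 58–59); App. B (pp. 73, 75)] -/
theorem nonempty_jPkg_midE_cut_term₂' (i i₀ : Fin (M + 1)) (hk : i₀.succ = i.castSucc) (κ : Fin d × Bool)
    (hb : (b i.castSucc).2 = (b i.castSucc).1 + stepVec κ) (hσ : (τ i).1 = true) (a₀ : Fin 3)
    (ha : a i.castSucc = Sum.inl a₀) {a' : Fin 3} (ha' : a i.succ = Sum.inl a')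
    (hty : t i.castSucc ≠ (b i.succ).1) (hzt : z i.castSucc = t i.castSucc)
    (hna : ¬ (zdGraph d).Adj (w i.succ) (t i.castSucc)) :
    Nonempty (JPkg p (jctx M x b w t z a τ i.castSucc) (JFacts M x b w t z a c τ)
      (kd (z i.castSucc) (t i.castSucc) *
        (blockAiota' (Letters.perc d p) κ a₀ a' (b i.castSucc).1 (w i.castSucc) (w i.succ) (t i.castSucc) *
          blockPS (Letters.perc d p) 0 ((b i.succ).1 - t i.castSucc) ((b i.succ).1 - t i.castSucc)))) := by
  by_cases h2 : a' = 2
  · subst h2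
    rw [blockAiota'_of_ne _ _ (fun h => absurd h.2 (by decide))]
    exact nonempty_jPkg_midE_cut_term₂ p M x b w t z a c τ i i₀ hk κ hb hσ a₀ ha ha' hty hzt hna
  · exact nonempty_jPkg_of_sharp p c _ i hσ ha' h2 hty _

end Packages

end Literature.Probability.FitznerVanDerHofstad2017

end
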